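import Literature.Analysis.FluidPDE.ChaeAsymptoticallySelfSimilarSmallness
import Literature.Analysis.FluidPDE.Seregin2020ScaledEnergyBoundsA
import HarnessLib

/-!
# Chae 2007, Theorem 1.5: smallness at one scale for every `q ≥ 2` (proofs companion, part 6)

Analysis/FluidPDE proofs file (theorems only: no definitions, no named facts), sixth companion of
`Literature/Analysis/FluidPDE/ChaeAsymptoticallySelfSimilar.lean` (D. Chae, Math. Ann. 338 (2007)
435–449 = arXiv:math/0604234, **Theorem 1.5**, the named fact
`chae2007_asymptoticallySelfSimilar_local`). The fifth companion
(`ChaeAsymptoticallySelfSimilarSmallness.lean`) reduced the fact to three inputs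
(`chae2007_asymptoticallySelfSimilar_local_of_localLerayInputs h₁ h₂ h₃`), the third being the
ε-regularity input for `2 ≤ q < 3`: for a suitable weak solution `(u, P)` in a parabolic ball
`Q(z, ρ)` (Albritton–Barker's class) whose scaled `L^∞_t L^q_x` quantity
`r^{(q−3)/q} ess sup_{s−r²<t<s} ‖u(t)‖_{L^q(B(a,r))}` falls below every level at all small scales
(Chae's (3.16)), the smallness of `C(r₀) + D(r₀)` at some scale `r₀ ≤ ρ` — the passage
"Hence, the conclusion follows from Theorem 3.1" of the printed proof (arXiv p. 8; Theorem 3.1 =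
Gustafson–Kang–Tsai, CMP 273 (2007), Thm 1.1, here with `(r, s) = (q, ∞)`, `3/q + 2/∞ ≤ 2`).
This file PROVES that input, for every `q ≥ 2` at once, from results already in the tree:

* `cknAEss_le_of_ae_eLpNorm_le` — Hölder on the ball: the scaled `L^∞_t L^q_x` bound at level
  `η` gives `A(r) = r⁻¹ ess sup_t ∫_{B_r} |u|² ≤ (η |B₁|^{(q−2)/(2q)})²` (`q ≥ 2`; `A = cknAEss`),
  i.e. Chae's hypothesis controls the scaled energy at every small scale;
* `exists_cknC_add_cknD_lt_of_ae_eLpNorm_small_of_two_le` — **smallness of `C + D` at one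
  scale, `q ≥ 2`**: with `A ≤ |B₁|^{(q−2)/q}` below a first radius `r₁`, Seregin's boundedness
  lemma for the case of a bounded energy quantity
  (`Seregin2020.scaledEnergies_bounded_of_cknAEss_le`: `A ≤ M` on `]0, r₁]`, `E(r₁), D(r₁) < ∞`
  `⇒ A + E + C + D ≤ K` on `]0, r₁/2]`) bounds the dissipation `E`; the multiplicative inequality
  in the finer form `C ≤ C₀ A^{3/4}(A + E)^{3/4}` (`Seregin2020.exists_cknC_le_finer`) then makes
  `C(r) ≤ η^{3/4} C₀ W^{3/4}(W + K)^{3/4}` (`W = |B₁|^{(q−2)/q}`) uniformly small below the radius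
  attached to the level `η ≤ 1`, and the pressure decay estimate
  (`seregin_sverak_pressure_decay_holds`, `D(θr) ≤ c(θD(r) + θ⁻²C(r))`) iterated along `θʲ r₂`
  (`cknD_iterate_le_of_pressure_decay`) makes `D` small as well — Gustafson–Kang–Tsai's §3 in the
  tree's vocabulary (their interpolation `‖u‖_{L³} ≤ ‖u‖_{L^q}^a ‖u‖_{L⁶}^{1−a}` is replaced by
  `L^q(B_r) ⊂ L²(B_r)` followed by the `L²`–`H¹` interpolation behind `C ≤ C₀A^{3/4}(A+E)^{3/4}`);
* `chae2007_asymptoticallySelfSimilar_local_of_localLerayInputs'` — **Theorem 1.5 from the two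
  remaining inputs**: `h₁` (regularity of very weak Leray profiles in `L^p`, `p ≥ 3`) and `h₂`
  (a suitable representative of the classical solution near `(z, T)` up to the blow-up time —
  local Leray theory).

## References

* D. Chae, Math. Ann. 338 (2007) = arXiv:math/0604234, proof of Thm 1.5, (3.15)–(3.16) and the
  appeal to Thm 3.1 (arXiv p. 8) [Chae2007].
* S. Gustafson, K. Kang, T.-P. Tsai, *Interior regularity criteria for suitable weak solutions of
  the Navier–Stokes equations*, Comm. Math. Phys. 273 (2007) 161–176, Thm 1.1 and §3
  [GustafsonKangTsai2007].
* G. Seregin, Anal. Math. Phys. 10 (2020), Paper 46 = arXiv:2006.04140, remark after Def. 1.7;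
  G. Seregin, *Lecture Notes on Regularity Theory for the Navier–Stokes Equations* (2014), §6.1
  [Seregin2020, Seregin2014].
* G. Seregin, V. Šverák, Comm. PDE 34 (2009) = arXiv:0804.1803, proof of Lemma 3.5, (as13)
  [SereginSverak2009].
-/

noncomputable section

open _root_.MeasureTheory Set Function Filter Metric TopologicalSpace
open scoped NNReal ENNReal _root_.Topology RealInnerProductSpace Laplacian

namespace Literature.Analysis.FluidPDE

section EnergySmallness

variable {u : ℝ → EuclideanSpace ℝ (Fin 3) → EuclideanSpace ℝ (Fin 3)}
  {p : ℝ → EuclideanSpace ℝ (Fin 3) → ℝ}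

/-- **The scaled energy under the scaled `L^∞_t L^q_x` bound, `q ≥ 2`** (Hölder on the ball,
`‖u(t)‖_{L²(B_r)} ≤ |B_r|^{1/2−1/q} ‖u(t)‖_{L^q(B_r)}`, `|B_r| = r³|B₁|`,
`3(1/2 − 1/q) = (q−3)/q + 1/2`): if for a.e. `t ∈ (s − r², s)` the slice `u(t)` is measurable on
`B(a, r)` with `r^{(q−3)/q} ‖u(t)‖_{L^q(B(a,r))} ≤ η`, then
`A(r) = ess sup_t r⁻¹ ∫_{B(a,r)} |u(t)|² ≤ (η |B₁|^{(q−2)/(2q)})²` (`A = cknAEss`, `z = (s, a)`):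
Chae's quantity (3.16) dominates Albritton–Barker's scaled energy at the same scale.
[cite: Chae2007, proof of Thm 1.5, (3.16) (arXiv p. 8); GustafsonKangTsai2007 §3] -/
theorem cknAEss_le_of_ae_eLpNorm_le {q : ℝ≥0} (hq : 2 ≤ q) {z : ℝ × EuclideanSpace ℝ (Fin 3)}
    {r η : ℝ} (hr : 0 < r)
    (hmeas : AEStronglyMeasurable (uncurry u) (volume.restrict (parabolicCylinder r z)))
    (hS : ∀ᵐ t ∂(volume.restrict (Ioo (z.1 - r ^ 2) z.1)),
      eLpNorm (u t) (q : ℝ≥0∞) (volume.restrict (ball z.2 r)) *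
        ENNReal.ofReal (r ^ (((q : ℝ) - 3) / q)) ≤ ENNReal.ofReal η) :
    cknAEss r z u ≤ (ENNReal.ofReal η *
      volume (ball (0 : EuclideanSpace ℝ (Fin 3)) 1) ^ (((q : ℝ) - 2) / (2 * q))) ^ 2 := by
  set V₁ : ℝ≥0∞ := volume (ball (0 : EuclideanSpace ℝ (Fin 3)) 1) with hV₁
  set b : ℝ := ((q : ℝ) - 2) / (2 * q) with hb
  set K : ℝ≥0∞ := ENNReal.ofReal η * V₁ ^ b with hK
  have hq2 : (2 : ℝ) ≤ q := by exact_mod_cast hq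
  have hqpos : (0 : ℝ) < q := by linarith
  have hb0 : 0 ≤ b := by rw [hb]; exact div_nonneg (by linarith) (by positivity)
  -- measure of the ball
  have hvol : volume (ball z.2 r) = ENNReal.ofReal (r ^ 3) * V₁ := by
    rw [hV₁, Measure.addHaar_ball_of_pos volume z.2 hr, finrank_euclideanSpace_fin]
  -- slice measurability
  have hprod : (volume.restrict (parabolicCylinder r z) : Measure (ℝ × EuclideanSpace ℝ (Fin 3))) =
      ((volume : Measure ℝ).restrict (Ioo (z.1 - r ^ 2) z.1)).prod
        ((volume : Measure (EuclideanSpace ℝ (Fin 3))).restrict (ball z.2 r)) := by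
    rw [parabolicCylinder, Measure.volume_eq_prod, Measure.prod_restrict]
  have hslice : ∀ᵐ t ∂(volume.restrict (Ioo (z.1 - r ^ 2) z.1)),
      AEStronglyMeasurable (u t) (volume.restrict (ball z.2 r)) := by
    have h := hmeas
    rw [hprod] at h
    exact h.prodMk_left
  rw [cknAEss]
  refine essSup_le_of_ae_le _ ?_
  filter_upwards [hS, hslice] with t ht hmt
  have hq2' : (2 : ℝ≥0∞) ≤ (q : ℝ≥0∞) := by exact_mod_cast hq
  -- Hölder on the ball: `‖u‖₂ ≤ ‖u‖_q |B_r|^{1/2 - 1/q}`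
  have h1 := eLpNorm_le_eLpNorm_mul_rpow_measure_univ hq2' hmt
  rw [Measure.restrict_apply_univ, hvol] at h1
  have hexp : 1 / (2 : ℝ≥0∞).toReal - 1 / ((q : ℝ≥0∞)).toReal = b := by
    simp only [ENNReal.toReal_ofNat, ENNReal.coe_toReal, hb]
    field_simp
  rw [hexp] at h1
  have hsplit : (ENNReal.ofReal (r ^ 3) * V₁) ^ b =
      ENNReal.ofReal (r ^ (((q : ℝ) - 3) / q)) * ENNReal.ofReal (r ^ (1 / 2 : ℝ)) * V₁ ^ b := by
    rw [ENNReal.mul_rpow_of_nonneg _ _ hb0, ENNReal.ofReal_rpow_of_nonneg (by positivity) hb0,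
      ← Real.rpow_natCast, ← Real.rpow_mul hr.le, ← ENNReal.ofReal_mul (by positivity),
      ← Real.rpow_add hr]
    congr 2
    rw [hb]
    push_cast
    field_simp
    ring
  rw [hsplit] at h1
  have h2 : eLpNorm (u t) 2 (volume.restrict (ball z.2 r)) ≤
      K * ENNReal.ofReal (r ^ (1 / 2 : ℝ)) := by
    calc eLpNorm (u t) 2 (volume.restrict (ball z.2 r))
        ≤ eLpNorm (u t) (q : ℝ≥0∞) (volume.restrict (ball z.2 r)) *
            (ENNReal.ofReal (r ^ (((q : ℝ) - 3) / q)) * ENNReal.ofReal (r ^ (1 / 2 : ℝ)) *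
              V₁ ^ b) := h1
      _ = (eLpNorm (u t) (q : ℝ≥0∞) (volume.restrict (ball z.2 r)) *
            ENNReal.ofReal (r ^ (((q : ℝ) - 3) / q))) * V₁ ^ b *
              ENNReal.ofReal (r ^ (1 / 2 : ℝ)) := by ring
      _ ≤ ENNReal.ofReal η * V₁ ^ b * ENNReal.ofReal (r ^ (1 / 2 : ℝ)) := by gcongr
      _ = K * ENNReal.ofReal (r ^ (1 / 2 : ℝ)) := by rw [hK]
  -- `∫ |u|² = ‖u‖₂²`
  have h3 : ∫⁻ x in ball z.2 r, ‖u t x‖ₑ ^ 2 =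
      eLpNorm (u t) 2 (volume.restrict (ball z.2 r)) ^ 2 := by
    rw [eLpNorm_eq_lintegral_rpow_enorm_toReal (by norm_num) (by norm_num)]
    simp only [ENNReal.toReal_ofNat, one_div]
    rw [← ENNReal.rpow_natCast _ 2, ← ENNReal.rpow_mul]
    norm_num
  rw [h3]
  have hsq : ENNReal.ofReal (r ^ (1 / 2 : ℝ)) ^ 2 = ENNReal.ofReal r := by
    rw [← ENNReal.ofReal_pow (by positivity), ← Real.rpow_natCast,
      ← Real.rpow_mul hr.le]
    norm_num
  calc (ENNReal.ofReal r)⁻¹ * eLpNorm (u t) 2 (volume.restrict (ball z.2 r)) ^ 2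
      ≤ (ENNReal.ofReal r)⁻¹ * (K * ENNReal.ofReal (r ^ (1 / 2 : ℝ))) ^ 2 := by gcongr
    _ = ((ENNReal.ofReal r)⁻¹ * ENNReal.ofReal r) * K ^ 2 := by rw [mul_pow, hsq]; ring
    _ = K ^ 2 := by
        rw [ENNReal.inv_mul_cancel (ENNReal.ofReal_pos.2 hr).ne' ENNReal.ofReal_ne_top, one_mul]

/-- **Smallness of `C + D` at one scale from the scaled `L^∞_t L^q_x` criterion, `q ≥ 2`**
(Chae 2007, proof of Thm 1.5, last paragraph: (3.16) ⇒ the hypothesis of Thm 3.1 =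
Gustafson–Kang–Tsai 2007, Thm 1.1 with `(r, s) = (q, ∞)`; here through Seregin's boundedness
lemma for the case of a bounded energy quantity, the multiplicative inequality in its finer form
and the pressure decay estimate of Seregin–Šverák, all proved in the tree). Let `(u, p)` be a
suitable weak solution in the parabolic ball `Q(z, ρ)` (Albritton–Barker's class
`IsSuitableWeakSolutionInBall`) and `q ≥ 2`, and suppose that for every `η > 0` there is a
radius `r₁ ≤ ρ` below which `r^{(q−3)/q} ‖u(t)‖_{L^q(B(a,r))} ≤ η` for a.e. `t ∈ (s − r², s)`
(`z = (s, a)`). Then for every `ε > 0` there is `0 < r₀ ≤ ρ` with `C(r₀) + D(r₀) < ε`.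
Proof: at level `1` the scaled energy is bounded, `A ≤ W = |B₁|^{(q−2)/q}` on `]0, r₁]`
(`cknAEss_le_of_ae_eLpNorm_le`), and `E(r₁), D(r₁) < ∞` by the global class of the ball, so
`E, D ≤ K` on `]0, r₁/2]` (`Seregin2020.scaledEnergies_bounded_of_cknAEss_le`); at a level
`η ≤ 1`, `A ≤ ηW` below `r₂ ≤ r₁/2` and `C ≤ C₀A^{3/4}(A+E)^{3/4} ≤ η^{3/4} C₀ W^{3/4}(W+K)^{3/4}`
(`Seregin2020.exists_cknC_le_finer`); finally `D(θᴶr₂) ≤ 2^{-J}K + 2cθ⁻² sup C`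
(`cknD_iterate_le_of_pressure_decay`), and `η`, `J` are chosen from `ε`.
[cite: Chae2007, proof of Thm 1.5, (3.16) ⇒ Thm 3.1 (arXiv p. 8); GustafsonKangTsai2007 Thm 1.1, §3] -/
theorem exists_cknC_add_cknD_lt_of_ae_eLpNorm_small_of_two_le {ρ : ℝ}
    {z : ℝ × EuclideanSpace ℝ (Fin 3)} (hIB : IsSuitableWeakSolutionInBall ρ z u p)
    {q : ℝ≥0} (hq : 2 ≤ q)
    (hS : ∀ η : ℝ, 0 < η → ∃ r₁ : ℝ, 0 < r₁ ∧ r₁ ≤ ρ ∧ ∀ r : ℝ, 0 < r → r ≤ r₁ →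
      ∀ᵐ t ∂(volume.restrict (Ioo (z.1 - r ^ 2) z.1)),
        eLpNorm (u t) (q : ℝ≥0∞) (volume.restrict (ball z.2 r)) *
          ENNReal.ofReal (r ^ (((q : ℝ) - 3) / q)) ≤ ENNReal.ofReal η)
    {ε : ℝ} (hε : 0 < ε) :
    ∃ r₀ : ℝ, 0 < r₀ ∧ r₀ ≤ ρ ∧ cknC r₀ z u + cknD r₀ z p < ENNReal.ofReal ε := by
  obtain ⟨hsuit, -, ⟨G, hG, hG2⟩, hp⟩ := hIB
  have hdist : IsDistributionalNSSolutionOn (parabolicCylinderOpens ρ z) 1 0 u p :=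
    hsuit.distributional
  have hmeasρ : AEStronglyMeasurable (uncurry u) (volume.restrict (parabolicCylinder ρ z)) :=
    hdist.1.aestronglyMeasurable
  have hmeas_of : ∀ r : ℝ, 0 < r → r ≤ ρ →
      AEStronglyMeasurable (uncurry u) (volume.restrict (parabolicCylinder r z)) := fun r hr hrρ =>
    hmeasρ.mono_measure (Measure.restrict_mono (parabolicCylinder_mono hr.le hrρ z) le_rfl)
  -- ### constants
  obtain ⟨c, hPD⟩ := seregin_sverak_pressure_decay_holds.ratio
  obtain ⟨θ, hθ, hθhalf, hcθ⟩ := exists_ratio_mul_le_half c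
  have hθ1 : θ ≤ 1 := hθhalf.trans (by norm_num)
  obtain ⟨C₀, hC₀⟩ := Seregin2020.exists_cknC_le_finer
  set V₁ : ℝ≥0∞ := volume (ball (0 : EuclideanSpace ℝ (Fin 3)) 1) with hV₁
  have hV₁top : V₁ ≠ ∞ := measure_ball_lt_top.ne
  set b : ℝ := ((q : ℝ) - 2) / (2 * q) with hb
  have hq2 : (2 : ℝ) ≤ q := by exact_mod_cast hq
  have hb0 : 0 ≤ b := by rw [hb]; exact div_nonneg (by linarith) (by positivity)
  set W : ℝ≥0∞ := (V₁ ^ b) ^ 2 with hW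
  have hWtop : W ≠ ∞ := ENNReal.pow_ne_top (ENNReal.rpow_ne_top_of_nonneg hb0 hV₁top)
  set Θ : ℝ≥0∞ := ENNReal.ofReal ((θ⁻¹) ^ 2) with hΘ
  set L : ℝ≥0∞ := 1 + 2 * ((c : ℝ≥0∞) * Θ) with hL
  have hLtop : L ≠ ∞ := ENNReal.add_ne_top.2 ⟨ENNReal.one_ne_top,
    ENNReal.mul_ne_top ENNReal.ofNat_ne_top
      (ENNReal.mul_ne_top ENNReal.coe_ne_top ENNReal.ofReal_ne_top)⟩
  set εE : ℝ≥0∞ := ENNReal.ofReal (ε / 2) with hεE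
  have hε4 : 0 < εE / 4 :=
    ENNReal.div_pos (ENNReal.ofReal_pos.2 (by positivity)).ne' ENNReal.ofNat_ne_top
  -- the scaled energy below a level
  have hA_of : ∀ {η r₁ : ℝ}, 0 < η → r₁ ≤ ρ → (∀ r : ℝ, 0 < r → r ≤ r₁ →
      ∀ᵐ t ∂(volume.restrict (Ioo (z.1 - r ^ 2) z.1)),
        eLpNorm (u t) (q : ℝ≥0∞) (volume.restrict (ball z.2 r)) *
          ENNReal.ofReal (r ^ (((q : ℝ) - 3) / q)) ≤ ENNReal.ofReal η) →
      ∀ r : ℝ, 0 < r → r ≤ r₁ → cknAEss r z u ≤ ENNReal.ofReal η ^ 2 * W := by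
    intro η r₁ hη hr₁ρ hSr r hr hrr₁
    have h := cknAEss_le_of_ae_eLpNorm_le hq hr (hmeas_of r hr (hrr₁.trans hr₁ρ))
      (hSr r hr hrr₁)
    rw [hW, ← mul_pow]
    exact h
  -- ### (1) level one: the scaled energy is bounded, hence so are `E`, `C`, `D` (Seregin)
  obtain ⟨r₁, hr₁, hr₁ρ, hS₁⟩ := hS 1 one_pos
  have hsub₁ : parabolicCylinder r₁ z ⊆ parabolicCylinder ρ z := parabolicCylinder_mono hr₁.le hr₁ρ z
  have hQ₁ : parabolicCylinder r₁ z ⊆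
      ((parabolicCylinderOpens ρ z : Opens (ℝ × EuclideanSpace ℝ (Fin 3))) :
        Set (ℝ × EuclideanSpace ℝ (Fin 3))) := hsub₁
  have hM₁ : ∀ r ∈ Ioc (0 : ℝ) r₁, cknAEss r z u ≤ W.toNNReal := by
    intro r hr
    rw [ENNReal.coe_toNNReal hWtop]
    have h := hA_of one_pos hr₁ρ hS₁ r hr.1 hr.2
    rwa [ENNReal.ofReal_one, one_pow, one_mul] at h
  have hE₁ : cknE r₁ z G ≠ ∞ := by
    refine ENNReal.mul_ne_top (ENNReal.inv_ne_top.2 (ENNReal.ofReal_pos.2 hr₁).ne') ?_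
    exact (lt_of_le_of_lt (lintegral_mono_set hsub₁) hG2).ne
  have hD₁ : cknD r₁ z p ≠ ∞ := by
    have hp32 : ∫⁻ w in parabolicCylinder ρ z, ‖p w.1 w.2‖ₑ ^ (3 / 2 : ℝ) < ∞ := by
      have h := lintegral_rpow_enorm_lt_top_of_eLpNorm_lt_top (by norm_num)
        (by simp [ENNReal.div_eq_top]) hp.2
      have e32 : ((3 / 2 : ℝ≥0∞)).toReal = (3 / 2 : ℝ) := by
        rw [ENNReal.toReal_div]; norm_num
      simpa only [e32, uncurry] using h
    refine ENNReal.mul_ne_top (ENNReal.inv_ne_top.2 (pow_ne_zero 2 (ENNReal.ofReal_pos.2 hr₁).ne')) ?_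
    exact (lt_of_le_of_lt (lintegral_mono_set hsub₁) hp32).ne
  obtain ⟨K, hK⟩ := Seregin2020.scaledEnergies_bounded_of_cknAEss_le hsuit hG hr₁ hQ₁ hE₁ hD₁ hM₁
  have hEK : ∀ r : ℝ, 0 < r → r ≤ r₁ / 2 → cknE r z G ≤ K := fun r hr hrr =>
    (le_add_self.trans (le_self_add.trans le_self_add)).trans (hK r ⟨hr, hrr⟩)
  have hDK : ∀ r : ℝ, 0 < r → r ≤ r₁ / 2 → cknD r z p ≤ K := fun r hr hrr =>
    le_add_self.trans (hK r ⟨hr, hrr⟩)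
  -- ### (2) the level `η`
  set N₀ : ℝ≥0∞ := (C₀ : ℝ≥0∞) * W ^ (3 / 4 : ℝ) * (W + K) ^ (3 / 4 : ℝ) with hN₀
  have hN₀top : N₀ ≠ ∞ := ENNReal.mul_ne_top
    (ENNReal.mul_ne_top ENNReal.coe_ne_top (ENNReal.rpow_ne_top_of_nonneg (by norm_num) hWtop))
    (ENNReal.rpow_ne_top_of_nonneg (by norm_num) (ENNReal.add_ne_top.2 ⟨hWtop, ENNReal.coe_ne_top⟩))
  obtain ⟨η₀, hη₀, hη₀lt⟩ := exists_forall_ofReal_rpow_mul_lt (s := 3 / 4) (by norm_num)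
    (ENNReal.mul_ne_top hLtop hN₀top) hε4
  set η : ℝ := min (η₀ / 2) 1 with hηdef
  have hη : 0 < η := lt_min (by positivity) one_pos
  have hη1 : η ≤ 1 := min_le_right _ _
  have hηη₀ : η < η₀ := (min_le_left _ _).trans_lt (by linarith)
  have hofη1 : ENNReal.ofReal η ≤ 1 := ENNReal.ofReal_le_one.2 hη1
  set e : ℝ≥0∞ := ENNReal.ofReal (η ^ (3 / 4 : ℝ)) * N₀ with he
  have hLe : L * e ≤ εE / 4 := by
    have := hη₀lt η hη hηη₀
    calc L * e = ENNReal.ofReal (η ^ (3 / 4 : ℝ)) * (L * N₀) := by rw [he]; ring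
      _ ≤ εE / 4 := this.le
  obtain ⟨rη, hrη, hrηρ, hSη⟩ := hS η hη
  set r₂ : ℝ := min rη (r₁ / 2) with hr₂def
  have hr₂ : 0 < r₂ := lt_min hrη (half_pos hr₁)
  have hr₂η : r₂ ≤ rη := min_le_left _ _
  have hr₂₁ : r₂ ≤ r₁ / 2 := min_le_right _ _
  have hr₂ρ : r₂ ≤ ρ := hr₂η.trans hrηρ
  -- `C ≤ e` below `r₂`
  have hCe : ∀ r : ℝ, 0 < r → r ≤ r₂ → cknC r z u ≤ e := by
    intro r hr hrr₂
    have hrρ : r ≤ ρ := hrr₂.trans hr₂ρ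
    have hA : cknAEss r z u ≤ ENNReal.ofReal η * W := by
      have h := hA_of hη hrηρ hSη r hr (hrr₂.trans hr₂η)
      refine h.trans (mul_le_mul' ?_ le_rfl)
      exact pow_le_of_le_one bot_le hofη1 two_ne_zero
    have hAW : cknAEss r z u ≤ W := hA.trans (mul_le_of_le_one_left bot_le hofη1)
    have hE : cknE r z G ≤ K := hEK r hr (hrr₂.trans hr₂₁)
    have hAtop : cknAEss r z u ≠ ∞ := ne_top_of_le_ne_top hWtop hAW
    have hEtop : cknE r z G ≠ ∞ := ne_top_of_le_ne_top ENNReal.coe_ne_top hE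
    have hGr : HasWeakSpatialGradientOn (parabolicCylinderOpens r z) u G := by
      have hle : parabolicCylinderOpens r z ≤ parabolicCylinderOpens ρ z :=
        parabolicCylinder_mono hr.le hrρ z
      exact hG.mono hle
    have hfiner := hC₀ u G z r hr hGr hAtop hEtop
    have h34 : (0 : ℝ) ≤ 3 / 4 := by norm_num
    calc cknC r z u
        ≤ C₀ * cknAEss r z u ^ (3 / 4 : ℝ) * (cknAEss r z u + cknE r z G) ^ (3 / 4 : ℝ) := hfiner
      _ ≤ C₀ * (ENNReal.ofReal η * W) ^ (3 / 4 : ℝ) * (W + K) ^ (3 / 4 : ℝ) := by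
          gcongr
      _ = ENNReal.ofReal (η ^ (3 / 4 : ℝ)) * ((C₀ : ℝ≥0∞) * W ^ (3 / 4 : ℝ) * (W + K) ^ (3 / 4 : ℝ)) := by
          rw [ENNReal.mul_rpow_of_nonneg _ _ h34, ENNReal.ofReal_rpow_of_pos hη]
          ring
      _ = e := by rw [he, hN₀]
  -- ### (3) the number of steps and the final scale `s = θᴶ r₂`
  have hKtop : (K : ℝ≥0∞) ≠ ∞ := ENNReal.coe_ne_top
  obtain ⟨J, hJ⟩ := exists_inv_two_pow_mul_le hKtop hε4
  set s : ℝ := θ ^ J * r₂ with hsdef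
  have hs : 0 < s := by positivity
  have hsr₂ : s ≤ r₂ := mul_le_of_le_one_left hr₂.le (pow_le_one₀ hθ.le hθ1)
  have hscale0 : ∀ j : ℕ, 0 < θ ^ j * r₂ := fun j => by positivity
  have hscale1 : ∀ j : ℕ, θ ^ j * r₂ ≤ r₂ := fun j =>
    mul_le_of_le_one_left hr₂.le (pow_le_one₀ hθ.le hθ1)
  have hsubQ : parabolicCylinder r₂ z ⊆
      ((parabolicCylinderOpens ρ z : Opens (ℝ × EuclideanSpace ℝ (Fin 3))) :
        Set (ℝ × EuclideanSpace ℝ (Fin 3))) :=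
    parabolicCylinder_mono hr₂.le hr₂ρ z
  have hD : cknD s z p ≤ (2⁻¹ : ℝ≥0∞) ^ J * cknD r₂ z p + 2 * ((c : ℝ≥0∞) * Θ * e) :=
    cknD_iterate_le_of_pressure_decay hPD hθ hθ1 hcθ hdist hr₂ hsubQ
      (fun j _ => hCe _ (hscale0 j) (hscale1 j))
  have hD0 : cknD r₂ z p ≤ K := hDK r₂ hr₂ hr₂₁
  have hsmall : cknC s z u + cknD s z p ≤ εE := by
    have h1 : cknC s z u ≤ e := hCe s hs hsr₂
    have h3 : (2⁻¹ : ℝ≥0∞) ^ J * cknD r₂ z p ≤ εE / 4 := le_trans (by gcongr) hJ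
    calc cknC s z u + cknD s z p
        ≤ e + ((2⁻¹ : ℝ≥0∞) ^ J * cknD r₂ z p + 2 * ((c : ℝ≥0∞) * Θ * e)) := add_le_add h1 hD
      _ = L * e + (2⁻¹ : ℝ≥0∞) ^ J * cknD r₂ z p := by rw [hL]; ring
      _ ≤ εE / 4 + εE / 4 := add_le_add hLe h3
      _ ≤ εE / 4 + εE / 4 + εE / 4 := le_self_add
      _ ≤ εE := ENNReal.add_quarters_le εE
  refine ⟨s, hs, hsr₂.trans hr₂ρ, hsmall.trans_lt ?_⟩
  rw [hεE]
  exact (ENNReal.ofReal_lt_ofReal_iff hε).2 (by linarith)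

end EnergySmallness

/-! ### The assembly from the two remaining inputs -/

section Assembly

/-- **Chae 2007, Theorem 1.5, from very weak Leray-profile regularity and local Leray theory up
to the blow-up time.** Same as `chae2007_asymptoticallySelfSimilar_local_of_localLerayInputs`,
with its third input — the ε-regularity smallness for `2 ≤ q < 3` (Gustafson–Kang–Tsai 2007,
Thm 1.1 with `L^∞_t L^q_x`) — now PROVED
(`exists_cknC_add_cknD_lt_of_ae_eLpNorm_small_of_two_le`). The two remaining inputs:

* `h₁` — **regularity of very weak Leray profiles**: an `L^p` field (`p ≥ 3`), weakly divergence
  free, solving Leray's system `ΔV − ½V − ½(y·∇)V − (V·∇)V − ∇P = 0` in the very weak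
  (divergence-free-tested) sense, agrees a.e. with a `C²` Leray profile (`IsLerayProfile 1 ½ U P`)
  — the regularity implicit in Chae's appeal to Nečas–Růžička–Šverák (`p = 3`) and Tsai
  (`p > 3`), whose theorems (`necas_ruzicka_sverak_holds`, `tsai_selfsimilar_holds`) are stated
  for the pointwise profile class;
* `h₂` — **a suitable representative up to the final time**: for the classical solution
  `v ∈ C([0,T); L^p)` and every `z`, some pair `(u, P)` of Albritton–Barker's class in a parabolic
  ball `Q((T, z), ρ)`, `ρ² ≤ T`, with `u = v` a.e. there — in print the output of local Leray theory
  (a local Leray solution on `(0, T') × ℝ³`, `T' > T`, from `v(0) ∈ L^p ⊂ E²`, identified with `v`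
  on `(0, T)` by weak–strong uniqueness; cf. the tree's facts
  `localEnergySolution_exists_local_of_memE2`, `localEnergySolution_extension_of_memE2`,
  `local_leray_weak_strong_uniqueness`).
[cite: Chae2007, Thm 1.5 and its proof (arXiv pp. 7–8)] -/
theorem chae2007_asymptoticallySelfSimilar_local_of_localLerayInputs'
    (h₁ : ∀ (V : EuclideanSpace ℝ (Fin 3) → EuclideanSpace ℝ (Fin 3)) (p : ℝ≥0), 3 ≤ p →
      MemLp V (p : ℝ≥0∞) volume → IsWeaklyDivFree V →
      (∀ Φ : EuclideanSpace ℝ (Fin 3) → EuclideanSpace ℝ (Fin 3),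
        FunctionSpaces.IsTestFunctionOn (⊤ : Opens (EuclideanSpace ℝ (Fin 3))) Φ →
        VectorCalculus.IsDivFree Φ →
        ∫ w, (⟪V w, (Δ Φ) w⟫ + ⟪V w, Φ w⟫ + 1 / 2 * ⟪V w, fderiv ℝ Φ w w⟫ +
          ⟪V w, fderiv ℝ Φ w (V w)⟫) = 0) →
      ∃ (U : EuclideanSpace ℝ (Fin 3) → EuclideanSpace ℝ (Fin 3)) (P : EuclideanSpace ℝ (Fin 3) → ℝ),
        IsLerayProfile 1 (1 / 2) U P ∧ V =ᵐ[volume] U)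
    (h₂ : ∀ ⦃T : ℝ⦄, 0 < T → ∀ ⦃p : ℝ≥0⦄, 3 ≤ p →
      ∀ ⦃v : ℝ → EuclideanSpace ℝ (Fin 3) → EuclideanSpace ℝ (Fin 3)⦄
        ⦃π : ℝ → EuclideanSpace ℝ (Fin 3) → ℝ⦄,
      IsClassicalNSSolutionOn (Ioo 0 T) 1 0 v π → ContinuousInLpOn (Ico 0 T) p v →
      ∀ z : EuclideanSpace ℝ (Fin 3), ∃ ρ : ℝ, 0 < ρ ∧ ρ ^ 2 ≤ T ∧
        ∃ (u : ℝ → EuclideanSpace ℝ (Fin 3) → EuclideanSpace ℝ (Fin 3))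
          (P : ℝ → EuclideanSpace ℝ (Fin 3) → ℝ),
          IsSuitableWeakSolutionInBall ρ (T, z) u P ∧
          uncurry u =ᵐ[volume.restrict (parabolicCylinder ρ (T, z))] uncurry v) :
    chae2007_asymptoticallySelfSimilar_local :=
  chae2007_asymptoticallySelfSimilar_local_of_localLerayInputs h₁ h₂
    fun _ _ _ _ _ hIB hq2 _ hS _ hε =>
      exists_cknC_add_cknD_lt_of_ae_eLpNorm_small_of_two_le hIB hq2 hS hε

end Assembly

end Literature.Analysis.FluidPDE

end
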